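import Literature.AlgebraicGeometry.ModuliOfAbelianVarieties.SiegelHeckeQuotientPeriodCompatible
import Literature.AlgebraicGeometry.AbelianSchemes.SymplecticLiftOfIsogenyTower
import Literature.AlgebraicGeometry.ModuliOfAbelianVarieties.SymplecticLiftOfMarking
import HarnessLib

/-!
# The Hecke isogeny quotient is admissible — SECTION-KERNEL edition (the kernel stated ALGEBRAICALLY, through the
# level-`N′` sections, instead of through every marking) ([Milne 2005] §5 Def. 5.14, §6 Thm. 6.11; [MFK94] Ch. 7 §1–§3)

Topic `AlgebraicGeometry/ModuliOfAbelianVarieties`; namespace `Literature.AlgebraicGeometry.ModuliOfAbelianVarieties`.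
KERNEL ONLY: theorems; no definition, no named fact, no instance, no `sorry`.

★ `isAdmissibleAt_heckeQuotient` (p743730) and ★ `hcompat_of_pointwiseHeckeQuotient` (p744448) take the kernel clause (K) in
MARKING form, for EVERY marking of the source fibre by `[J(Z), r′]` — stronger than the algebraic quotient construction exports
(two markings by the same point differ by an automorphism that need not preserve the kernel).  What it exports is the kernel
through the LEVEL SECTIONS: `ψ(P) = 1 ↔ P = σ′_c(𝟙)` for some `c ∈ K₀`, `K₀ := {c ∈ (ℤ/N′)^{2g} | some r′-lift v of c/N′ has
γv ∈ Λ_r}` (★ `LevelStructure.section_`).  This file bridges the two for a MATCHED marking (the one an admissibility datum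
carries) and restates both theorems with the algebraic (K):

* `exists_zmod_adelicCongr_of_nsmul_mem` — `N′•v ∈ Λ_{r′} ⇒ r′⁻¹v̂ ≡ c/N′` for some `c` (★ `exists_valDiv_sub_mem_latticeOfGL_one`).
* `map_r_eq_one_iff_of_sectionKernel` — the bridge: for a marking `m` matched to a symplectic lift of the level-`N′` structure
  through `r′` (`Λ′.lift M x = m.r v` whenever `r′⁻¹v̂ ≡ x/M`), the section kernel gives `ψ(m.r v) = 1 ↔ γv ∈ Λ_r` ((QA1), (QA2)
  with `N ∣ N′`; ★ `coe_lift_ofAdd_eq_restrictPt_section`, ★ `r_eq_r_iff_sub_mem_latticeOfGL`).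
* `isAdmissibleAt_heckeQuotient_of_sectionKernel` — ★ p743730 with (K) algebraic.
* `hcompat_of_pointwiseHeckeQuotient_of_sectionKernel` — ★ p744448 with (K) algebraic AND the source at `s` any triple `U′` over
  `Spec ℂ` of class `ι′ s` (the algebraic source `(univ.baseChange ι′_ℚ).baseChange s` is such a `U′`, ≅ but not = `univ.baseChange y`).

## References
* [Milne2005ShimuraVarieties] §5 p. 58 (Def. 5.14), §6 Thm. 6.11 pp. 74–75.
* [MumfordFogartyKirwan1994] Ch. 7 §1 Def. 7.1 and §2 Def. 7.2 (p. 129), §3 (p. 139).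
HC_CM is proved only modulo the 7 printed citations until rung 0 closes; this file discharges none of them.
-/

set_option autoImplicit false

noncomputable section

open CategoryTheory AlgebraicGeometry Matrix
open Literature.AlgebraicGeometry.Motives (AbelianVariety AlgPoints CartierDivisor specOver ComplexPoints)
open Literature.AlgebraicGeometry.AbelianSchemes (AbelianSchemeOver PolarizedAbelianSchemeWithLevel)
open Literature.Geometry.Kaehler (ComplexTorus)
open Literature.Geometry.Kaehler.ComplexTorus (AHData proj intGram picClass)
open Literature.NumberTheory.Transcendental (IsAnalytification)
open Literature.AlgebraicGeometry.HodgeTheory (cartierDivisorLineBundle)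
open Literature.NumberTheory.Adeles
open Literature.NumberTheory.Automorphic (siegelUpperHalfSpace)

namespace Literature.AlgebraicGeometry.ModuliOfAbelianVarieties

open SiegelModuli
open scoped MonObj

variable {g : ℕ} {δ : Fin g → ℕ}

/-! ### §1 The bridge: section kernel ⇒ marking kernel for a matched marking -/

/-- **`N′•v ∈ Λ_{r′} ⇒ r′⁻¹v̂ ≡ c/N′ (mod ℤ̂)` for some class `c ∈ (ℤ/N′)^{2g}`.** [cite: Milne2005ShimuraVarieties, §6 Thm. 6.11 p. 74 and p. 75] -/
theorem exists_zmod_adelicCongr_of_nsmul_mem {M : ℕ} (hM : M ≠ 0) (r' : gspFinAdelic δ) {v : Fin g ⊕ Fin g → ℚ}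
    (hv : M • v ∈ latticeOfGL (r' : GL (Fin g ⊕ Fin g) finAdeleQ)) :
    ∃ c : Fin g ⊕ Fin g → ZMod M,
      AdelicCongr ((r'⁻¹ : gspFinAdelic δ) : GL (Fin g ⊕ Fin g) finAdeleQ) 1 v (fun i => ((c i).val : ℚ) / M) := by
  obtain ⟨w, hw⟩ := exists_adelicCongr_right ((r'⁻¹ : gspFinAdelic δ) : GL (Fin g ⊕ Fin g) finAdeleQ) 1 v
  have hw' : M • w ∈ latticeOfGL (1 : GL (Fin g ⊕ Fin g) finAdeleQ) := by
    have h := (hw.nsmul_mem_latticeOfGL_iff M).1 (by rwa [latticeOfGL_inv_coe_inv_eq])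
    rwa [inv_one] at h
  obtain ⟨c, hc⟩ := SiegelAdelicMarking.exists_valDiv_sub_mem_latticeOfGL_one hM hw'
  exact ⟨c, hw.of_sub_mem_latticeOfGL_right (by rwa [inv_one])⟩

/-- **THE BRIDGE «section kernel ⇒ marking kernel» for a MATCHED marking.**  Let `A` be an abelian scheme over `Spec ℂ` with a
level-`N′` structure `η′` and a symplectic lift `Λ′` at the identity point matched to a marking `m` of the fibre by `[J(Z), r′]`
(`Λ′.lift M x = m.r v` whenever `r′⁻¹v̂ ≡ x/M`), let `ψ` be a homomorphism out of the fibre whose kernel on ℂ-points is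
`{σ′_c(𝟙) | c ∈ K₀}`, `K₀ = {c | ∃ v, γv ∈ Λ_r ∧ r′⁻¹v̂ ≡ c/N′}`, and assume (QA1) `γΛ_{r′} ⊆ Λ_r`, (QA2) `N′•γ⁻¹Λ_r ⊆ N•Λ_{r′}`.  Then
`ψ(m.r v) = 1 ↔ γv ∈ Λ_r` for every rational `v`. [cite: Milne2005ShimuraVarieties, §6 Thm. 6.11 p. 74 and p. 75]
[cite: MumfordFogartyKirwan1994, Ch. 7 §1 Definition 7.1 (p. 129)] -/
theorem map_r_eq_one_iff_of_sectionKernel (hδ : IsPolarizationType δ) {N N' : ℕ} (hN'0 : N' ≠ 0)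
    {Z : Matrix (Fin g) (Fin g) ℂ} (hZ : Z ∈ siegelUpperHalfSpace g) (r r' : gspFinAdelic δ) (γq : GL (Fin g ⊕ Fin g) ℚ)
    (hQA1 : ∀ v : Fin g ⊕ Fin g → ℚ, v ∈ latticeOfGL (r' : GL (Fin g ⊕ Fin g) finAdeleQ) →
      (γq : Matrix (Fin g ⊕ Fin g) (Fin g ⊕ Fin g) ℚ) *ᵥ v ∈ latticeOfGL (r : GL (Fin g ⊕ Fin g) finAdeleQ))
    (hQA2 : ∀ w : Fin g ⊕ Fin g → ℚ, w ∈ latticeOfGL (r : GL (Fin g ⊕ Fin g) finAdeleQ) →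
      ∃ v : Fin g ⊕ Fin g → ℚ, v ∈ latticeOfGL (r' : GL (Fin g ⊕ Fin g) finAdeleQ) ∧
        (N' : ℚ) • (((γq⁻¹ : GL (Fin g ⊕ Fin g) ℚ) : Matrix (Fin g ⊕ Fin g) (Fin g ⊕ Fin g) ℚ) *ᵥ w) = (N : ℚ) • v)
    {A : AbelianSchemeOver (specOver ℚ ℂ).left} (η' : A.LevelStructure g N') {B : AbelianVariety ℂ}
    (ψ : (A.fibre (𝟙 (Spec (CommRingCat.of ℂ)))).toAbelianVariety ⟶ B)
    (m : SiegelAdelicMarking ⟨jOfSiegel δ Z, SiegelComplexRecordSystem.jOfSiegel_mem_C0pm hδ.1 hZ⟩ r'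
      (A.fibre (𝟙 (Spec (CommRingCat.of ℂ)))).toAbelianVariety)
    {Θ' : CartierDivisor (A.fibre (𝟙 (Spec (CommRingCat.of ℂ)))).toAbelianVariety.X.left}
    (Λ' : η'.SymplecticLift (𝟙 (Spec (CommRingCat.of ℂ))) Θ' δ)
    (hΛ' : ∀ ⦃M : ℕ⦄, N' ∣ M → M ≠ 0 → ∀ (x : Fin g ⊕ Fin g → ZMod M) (v : Fin g ⊕ Fin g → ℚ),
        AdelicCongr ((r'⁻¹ : gspFinAdelic δ) : GL (Fin g ⊕ Fin g) finAdeleQ) 1 v (fun i => ((x i).val : ℚ) / M) →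
          ((Λ'.lift M (Multiplicative.ofAdd x)) : (A.fibre (𝟙 (Spec (CommRingCat.of ℂ)))).toAbelianVariety.Points ℂ)
            = m.r v)
    (hker : ∀ P : (A.fibre (𝟙 (Spec (CommRingCat.of ℂ)))).toAbelianVariety.Points ℂ,
      AlgPoints.map ψ.hom.hom.hom P = 1 ↔
        ∃ c : Fin g ⊕ Fin g → ZMod N',
          (∃ v : Fin g ⊕ Fin g → ℚ,
            (γq : Matrix (Fin g ⊕ Fin g) (Fin g ⊕ Fin g) ℚ) *ᵥ v ∈ latticeOfGL (r : GL (Fin g ⊕ Fin g) finAdeleQ) ∧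
            AdelicCongr ((r'⁻¹ : gspFinAdelic δ) : GL (Fin g ⊕ Fin g) finAdeleQ) 1 v (fun i => ((c i).val : ℚ) / N')) ∧
          P = A.restrictPt (𝟙 (Spec (CommRingCat.of ℂ))) (η'.section_ c))
    (v : Fin g ⊕ Fin g → ℚ) :
    AlgPoints.map ψ.hom.hom.hom (m.r v) = 1 ↔
      (γq : Matrix (Fin g ⊕ Fin g) (Fin g ⊕ Fin g) ℚ) *ᵥ v ∈ latticeOfGL (r : GL (Fin g ⊕ Fin g) finAdeleQ) := by
  haveI : NeZero N' := ⟨hN'0⟩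
  -- readings through `r′` at level `N′` name the sections: `σ′_c(𝟙) = Λ′.lift N′ c = m.r v_c`
  have hsec : ∀ (c : Fin g ⊕ Fin g → ZMod N') (w : Fin g ⊕ Fin g → ℚ),
      AdelicCongr ((r'⁻¹ : gspFinAdelic δ) : GL (Fin g ⊕ Fin g) finAdeleQ) 1 w (fun i => ((c i).val : ℚ) / N') →
        A.restrictPt (𝟙 (Spec (CommRingCat.of ℂ))) (η'.section_ c) = m.r w := by
    intro c w hw
    rw [← Λ'.coe_lift_ofAdd_eq_restrictPt_section]
    exact hΛ' (dvd_refl N') hN'0 c w hw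
  -- `γ`-integrality of differences: if `γ v₁ ∈ Λ_r` and `v₂ − v₁ ∈ Λ_{r′}` then `γ v₂ ∈ Λ_r`
  have hshift : ∀ v₁ v₂ : Fin g ⊕ Fin g → ℚ,
      (γq : Matrix (Fin g ⊕ Fin g) (Fin g ⊕ Fin g) ℚ) *ᵥ v₁ ∈ latticeOfGL (r : GL (Fin g ⊕ Fin g) finAdeleQ) →
      v₂ - v₁ ∈ latticeOfGL (r' : GL (Fin g ⊕ Fin g) finAdeleQ) →
      (γq : Matrix (Fin g ⊕ Fin g) (Fin g ⊕ Fin g) ℚ) *ᵥ v₂ ∈ latticeOfGL (r : GL (Fin g ⊕ Fin g) finAdeleQ) := by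
    intro v₁ v₂ h₁ h₁₂
    have h := (latticeOfGL (r : GL (Fin g ⊕ Fin g) finAdeleQ)).add_mem h₁ (hQA1 _ h₁₂)
    rwa [← Matrix.mulVec_add, add_sub_cancel] at h
  constructor
  · intro h1
    obtain ⟨c, ⟨v₁, hγv₁, hv₁⟩, hP⟩ := (hker (m.r v)).1 h1
    -- `m.r v = σ′_c(𝟙) = m.r v₁`, so `v − v₁ ∈ Λ_{r′}`
    rw [hsec c v₁ hv₁] at hP
    have hsub : v - v₁ ∈ latticeOfGL (r' : GL (Fin g ⊕ Fin g) finAdeleQ) :=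
      (m.r_eq_r_iff_sub_mem_latticeOfGL v v₁).1 hP
    exact hshift v₁ v hγv₁ hsub
  · intro hγv
    -- `N′•v ∈ Λ_{r′}` by (QA2), so `r′⁻¹v̂ ≡ c/N′` for some `c`, and `m.r v = σ′_c(𝟙)` is in the kernel
    have hN'v : N' • v ∈ latticeOfGL (r' : GL (Fin g ⊕ Fin g) finAdeleQ) := by
      obtain ⟨v₀, hv₀, hvv₀⟩ := hQA2 _ hγv
      have hinv : (((γq⁻¹ : GL (Fin g ⊕ Fin g) ℚ) : Matrix (Fin g ⊕ Fin g) (Fin g ⊕ Fin g) ℚ)) *ᵥ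
          ((γq : Matrix (Fin g ⊕ Fin g) (Fin g ⊕ Fin g) ℚ) *ᵥ v) = v := by
        rw [Matrix.mulVec_mulVec, ← Units.val_mul, inv_mul_cancel, Units.val_one, Matrix.one_mulVec]
      rw [hinv] at hvv₀
      rw [← Nat.cast_smul_eq_nsmul ℚ N' v, hvv₀, Nat.cast_smul_eq_nsmul]
      exact (latticeOfGL (r' : GL (Fin g ⊕ Fin g) finAdeleQ)).nsmul_mem hv₀ N
    obtain ⟨c, hc⟩ := exists_zmod_adelicCongr_of_nsmul_mem hN'0 r' hN'v
    exact (hker (m.r v)).2 ⟨c, ⟨v, hγv, hc⟩, (hsec c v hc).symm⟩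

/-! ### §2 (β) with the section kernel -/

/-- **THE HECKE ISOGENY QUOTIENT IS ADMISSIBLE AT `(θZ, r)` — section-kernel edition** of ★ `isAdmissibleAt_heckeQuotient`: the
kernel clause is «`ψ(P) = 1 ↔ P = σ′_c(𝟙)` for some `c ∈ K₀`» (level sections), everything else as there.
[cite: Milne2005ShimuraVarieties, §5 p. 58 (Def. 5.14) and §6 Thm. 6.11 p. 74 and p. 75]
[cite: MumfordFogartyKirwan1994, Ch. 7 §2 Definition 7.2 (p. 129)] -/
theorem isAdmissibleAt_heckeQuotient_of_sectionKernel {N N' d : ℕ} (hδ : IsPolarizationType δ) (hg : 0 < g)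
    (hN : 1 < N) (hd : N' = N * d) (hd0 : d ≠ 0)
    (Z : Matrix (Fin g) (Fin g) ℂ) (hZ : Z ∈ siegelUpperHalfSpace g)
    (Z' : Matrix (Fin g) (Fin g) ℂ) (hZ' : Z' ∈ siegelUpperHalfSpace g)
    (r r' : gspFinAdelic δ) (hr : r ∈ principalLevelSubgroup δ 1) (γq : GL (Fin g ⊕ Fin g) ℚ) (ν : ℕ)
    (hJ : jOfSiegel δ Z' = conjJ (Matrix.GeneralLinearGroup.map (algebraMap ℚ ℝ) γq) (jOfSiegel δ Z))
    (hQA : QuotientAdapted δ δ N N' r r' γq)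
    (hQA3 : (γq : Matrix (Fin g ⊕ Fin g) (Fin g ⊕ Fin g) ℚ)ᵀ * typeFormOver δ ℚ *
      (γq : Matrix (Fin g ⊕ Fin g) (Fin g ⊕ Fin g) ℚ) = (ν : ℚ) • typeFormOver δ ℚ)
    (P' : PolarizedAbelianSchemeWithLevel g N' δ (specOver ℚ ℂ).left)
    (Q : PolarizedAbelianSchemeWithLevel g N δ (specOver ℚ ℂ).left)
    (ψ : (P'.A.fibre (𝟙 (Spec (CommRingCat.of ℂ)))).toAbelianVariety ⟶ (Q.A.fibre (𝟙 (Spec (CommRingCat.of ℂ)))).toAbelianVariety)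
    [IsDominant ψ.hom.hom.hom.left]
    (hdim : (Q.A.fibre (𝟙 (Spec (CommRingCat.of ℂ)))).toAbelianVariety.dim = g)
    (hker : ∀ P : (P'.A.fibre (𝟙 (Spec (CommRingCat.of ℂ)))).toAbelianVariety.Points ℂ,
      AlgPoints.map ψ.hom.hom.hom P = 1 ↔
        ∃ c : Fin g ⊕ Fin g → ZMod N',
          (∃ v : Fin g ⊕ Fin g → ℚ,
            (γq : Matrix (Fin g ⊕ Fin g) (Fin g ⊕ Fin g) ℚ) *ᵥ v ∈ latticeOfGL (r : GL (Fin g ⊕ Fin g) finAdeleQ) ∧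
            AdelicCongr ((r'⁻¹ : gspFinAdelic δ) : GL (Fin g ⊕ Fin g) finAdeleQ) 1 v (fun i => ((c i).val : ℚ) / N')) ∧
          P = P'.A.restrictPt (𝟙 (Spec (CommRingCat.of ℂ))) (P'.level.section_ c))
    (hsurj : Function.Surjective (AlgPoints.map (L := ℂ) ψ.hom.hom.hom :
      (P'.A.fibre (𝟙 (Spec (CommRingCat.of ℂ)))).toAbelianVariety.Points ℂ →
        (Q.A.fibre (𝟙 (Spec (CommRingCat.of ℂ)))).toAbelianVariety.Points ℂ))
    (hlev : ∀ i : Fin g ⊕ Fin g,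
      Q.A.restrictPt (𝟙 (Spec (CommRingCat.of ℂ))) (Q.level.σ i) =
        AlgPoints.map ψ.hom.hom.hom (P'.A.restrictPt (𝟙 (Spec (CommRingCat.of ℂ))) (P'.level.σ i ^ d)))
    (hW : ∀ (Θ' : CartierDivisor (P'.A.fibre (𝟙 (Spec (CommRingCat.of ℂ)))).toAbelianVariety.X.left)
      (Θ : CartierDivisor (Q.A.fibre (𝟙 (Spec (CommRingCat.of ℂ)))).toAbelianVariety.X.left),
      P'.A.IsLambdaOfAt (𝟙 (Spec (CommRingCat.of ℂ))) P'.D P'.pol.lam Θ' →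
      Q.A.IsLambdaOfAt (𝟙 (Spec (CommRingCat.of ℂ))) Q.D Q.pol.lam Θ →
      ∀ x : (P'.A.fibre (𝟙 (Spec (CommRingCat.of ℂ)))).toAbelianVariety.Points ℂ,
        (((Θ.pullback ψ.hom.hom.hom.left + -(ν • Θ')).pullback
          ((P'.A.fibre (𝟙 (Spec (CommRingCat.of ℂ)))).toAbelianVariety.translation x).left).LinEquiv
          (Θ.pullback ψ.hom.hom.hom.left + -(ν • Θ'))))
    (hadm : IsAdmissibleAt hδ r' Z hZ P') : IsAdmissibleAt hδ r Z' hZ' Q := by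
  obtain ⟨hNd, ⟨k, hk, hrk⟩, hQA1, hQA2, hQA4, hQA3'⟩ := hQA
  have hr'eq : r' = r * k := Subtype.ext (by rw [Subgroup.coe_mul]; exact hrk)
  have hr' : r' ∈ principalLevelSubgroup δ 1 := hr'eq ▸ mul_mem hr (principalLevelSubgroup_anti δ (one_dvd N) hk)
  have hN'0 : N' ≠ 0 := by rw [hd]; exact Nat.mul_ne_zero (by omega) hd0
  -- unpack the admissibility datum of the source and re-base its marking to unit basis matrix
  obtain ⟨m₀, Θ', Λ', hΘ', hlam', hΛ'₀⟩ := hadm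
  obtain ⟨m, hmγ, -, hmr⟩ := SiegelAdelicMarking.exists_rebase_γ_eq_one hr' m₀
  have hΛ' : ∀ ⦃M : ℕ⦄, N' ∣ M → M ≠ 0 → ∀ (x : Fin g ⊕ Fin g → ZMod M) (v : Fin g ⊕ Fin g → ℚ),
      AdelicCongr ((r'⁻¹ : gspFinAdelic δ) : GL (Fin g ⊕ Fin g) finAdeleQ) 1 v (fun i => ((x i).val : ℚ) / M) →
        ((Λ'.lift M (Multiplicative.ofAdd x)) :
          (P'.A.fibre (𝟙 (Spec (CommRingCat.of ℂ)))).toAbelianVariety.Points ℂ) = m.r v := by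
    intro M hM hM0 x v hv
    rw [hmr]; exact hΛ'₀ hM hM0 x v hv
  -- THE BRIDGE: the section kernel gives the marking kernel for the matched marking `m`
  have hkerm : ∀ v : Fin g ⊕ Fin g → ℚ, AlgPoints.map ψ.hom.hom.hom (m.r v) = 1 ↔
      (γq : Matrix (Fin g ⊕ Fin g) (Fin g ⊕ Fin g) ℚ) *ᵥ v ∈ latticeOfGL (r : GL (Fin g ⊕ Fin g) finAdeleQ) :=
    map_r_eq_one_iff_of_sectionKernel hδ hN'0 hZ r r' γq hQA1 hQA2 P'.level ψ m Λ' hΛ' hker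
  -- (β1) ★: the quotient is marked by `[J(Z′), r]`; re-base to `m_B.γ = 1`
  obtain ⟨mB₀, hmB₀⟩ := SiegelAdelicMarking.exists_quotientMarking hδ Z hZ Z' hZ' r r' γq hJ hQA1 hQA3' _ _ m ψ hdim
    hkerm hsurj
  obtain ⟨mB, hmBγ, -, hmBr⟩ := SiegelAdelicMarking.exists_rebase_γ_eq_one hr mB₀
  have hmB : ∀ v : Fin g ⊕ Fin g → ℚ, mB.r v = AlgPoints.map ψ.hom.hom.hom
      (m.r ((((γq⁻¹ : GL (Fin g ⊕ Fin g) ℚ) : Matrix (Fin g ⊕ Fin g) (Fin g ⊕ Fin g) ℚ)) *ᵥ v)) := by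
    intro v; rw [hmBr, hmB₀]
  -- type frame (β3F) ★, level readings ★, conclusion ★
  obtain ⟨Θ, hΘ, hlam⟩ := Q.pol.exists_ample ℂ (𝟙 (Spec (CommRingCat.of ℂ)))
  obtain ⟨p, hp, hT⟩ := quotient_typeFrame hδ hg hN'0 hZ hZ' hr' γq ν hQA3 P' _ ψ m hmγ mB hmBγ hmB Θ' hΘ' hlam' Λ'
    hΛ' Θ (hW Θ' Θ hlam' hlam)
  have hlevel := quotient_levelReading hδ hN hd hd0 Z hZ Z' hZ' r r' γq hQA4 ⟨k, hk, hr'eq⟩ P'.level _ ψ m mB hmB Θ' Λ'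
    hΛ' (fun i => Q.A.restrictPt (𝟙 (Spec (CommRingCat.of ℂ))) (Q.level.σ i)) hlev
  exact isAdmissibleAt_of_levelReading_of_intGram_eq_typeForm hδ hg Q Θ hΘ hlam Z' hZ' hr mB mB.isAnalytification
    mB.toFun_add p hp hT (mB.r_eq_toFun_proj_of_γ_eq_one hmBγ) hlevel

/-! ### §3 The period-compatibility clause with the section kernel and a general source -/

/-- **PERIOD COMPATIBILITY OF A POINTWISE HECKE QUOTIENT — section-kernel edition, general source** (★
`hcompat_of_pointwiseHeckeQuotient` with (K) algebraic and the source at `s` ANY triple `U′` over `Spec ℂ` of class `ι′ s`).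
[cite: Milne2005ShimuraVarieties, §5 p. 58 (Def. 5.14) and §6 Thm. 6.11 p. 74 and p. 75]
[cite: MumfordFogartyKirwan1994, Ch. 7 §2 Definition 7.2 (p. 129)] -/
theorem hcompat_of_pointwiseHeckeQuotient_of_sectionKernel {N N' d : ℕ} (hδ : IsPolarizationType δ) (hg : 0 < g)
    (hN : 1 < N) (hd : N' = N * d) (hd0 : d ≠ 0)
    (𝓜 : SiegelFineModuliScheme g N δ) (𝓜' : SiegelFineModuliScheme g N' δ) [IsLocallyNoetherian (specOver ℚ ℂ).left]
    {S'' : Motives.SchemeOver ℂ} (ι' : S'' ⟶ (Motives.baseChange ℚ ℂ).obj 𝓜'.M)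
    (Φ : ComplexPoints S'' → ComplexPoints ((Motives.baseChange ℚ ℂ).obj 𝓜.M))
    (r r' : gspFinAdelic δ) (hr : r ∈ principalLevelSubgroup δ 1) (γq : GL (Fin g ⊕ Fin g) ℚ) (ν : ℕ)
    (θ : siegelUpperHalfSpace g → siegelUpperHalfSpace g)
    (hθ : ∀ Z : siegelUpperHalfSpace g, jOfSiegel δ ((θ Z : siegelUpperHalfSpace g) : Matrix (Fin g) (Fin g) ℂ) =
      conjJ (Matrix.GeneralLinearGroup.map (algebraMap ℚ ℝ) γq) (jOfSiegel δ (Z : Matrix (Fin g) (Fin g) ℂ)))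
    (hQA : QuotientAdapted δ δ N N' r r' γq)
    (hQA3 : (γq : Matrix (Fin g ⊕ Fin g) (Fin g ⊕ Fin g) ℚ)ᵀ * typeFormOver δ ℚ *
      (γq : Matrix (Fin g ⊕ Fin g) (Fin g ⊕ Fin g) ℚ) = (ν : ℚ) • typeFormOver δ ℚ)
    (hquot : ∀ s : ComplexPoints S'',
      ∃ (U : PolarizedAbelianSchemeWithLevel g N' δ (specOver ℚ ℂ).left)
        (_ : AlgPoints.baseChangeEquiv (algebraMap ℚ ℂ) 𝓜'.M (𝓜'.classifyingMap (specOver ℚ ℂ) U) =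
          AlgPoints.map (L := ℂ) ι' s)
        (Q : PolarizedAbelianSchemeWithLevel g N δ (specOver ℚ ℂ).left)
        (ψ : (U.A.fibre (𝟙 (Spec (CommRingCat.of ℂ)))).toAbelianVariety ⟶
          (Q.A.fibre (𝟙 (Spec (CommRingCat.of ℂ)))).toAbelianVariety)
        (_ : IsDominant ψ.hom.hom.hom.left),
        (Q.A.fibre (𝟙 (Spec (CommRingCat.of ℂ)))).toAbelianVariety.dim = g ∧
        (∀ P : (U.A.fibre (𝟙 (Spec (CommRingCat.of ℂ)))).toAbelianVariety.Points ℂ,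
          AlgPoints.map ψ.hom.hom.hom P = 1 ↔
            ∃ c : Fin g ⊕ Fin g → ZMod N',
              (∃ v : Fin g ⊕ Fin g → ℚ,
                (γq : Matrix (Fin g ⊕ Fin g) (Fin g ⊕ Fin g) ℚ) *ᵥ v ∈ latticeOfGL (r : GL (Fin g ⊕ Fin g) finAdeleQ) ∧
                AdelicCongr ((r'⁻¹ : gspFinAdelic δ) : GL (Fin g ⊕ Fin g) finAdeleQ) 1 v
                  (fun i => ((c i).val : ℚ) / N')) ∧
              P = U.A.restrictPt (𝟙 (Spec (CommRingCat.of ℂ))) (U.level.section_ c)) ∧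
        Function.Surjective (AlgPoints.map (L := ℂ) ψ.hom.hom.hom :
          (U.A.fibre (𝟙 (Spec (CommRingCat.of ℂ)))).toAbelianVariety.Points ℂ →
            (Q.A.fibre (𝟙 (Spec (CommRingCat.of ℂ)))).toAbelianVariety.Points ℂ) ∧
        (∀ i : Fin g ⊕ Fin g,
          Q.A.restrictPt (𝟙 (Spec (CommRingCat.of ℂ))) (Q.level.σ i) =
            AlgPoints.map ψ.hom.hom.hom (U.A.restrictPt (𝟙 (Spec (CommRingCat.of ℂ))) (U.level.σ i ^ d))) ∧
        (∀ (Θ' : CartierDivisor (U.A.fibre (𝟙 (Spec (CommRingCat.of ℂ)))).toAbelianVariety.X.left)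
          (Θ : CartierDivisor (Q.A.fibre (𝟙 (Spec (CommRingCat.of ℂ)))).toAbelianVariety.X.left),
          U.A.IsLambdaOfAt (𝟙 (Spec (CommRingCat.of ℂ))) U.D U.pol.lam Θ' →
          Q.A.IsLambdaOfAt (𝟙 (Spec (CommRingCat.of ℂ))) Q.D Q.pol.lam Θ →
          ∀ x : (U.A.fibre (𝟙 (Spec (CommRingCat.of ℂ)))).toAbelianVariety.Points ℂ,
            (((Θ.pullback ψ.hom.hom.hom.left + -(ν • Θ')).pullback
              ((U.A.fibre (𝟙 (Spec (CommRingCat.of ℂ)))).toAbelianVariety.translation x).left).LinEquiv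
              (Θ.pullback ψ.hom.hom.hom.left + -(ν • Θ')))) ∧
        AlgPoints.baseChangeEquiv (algebraMap ℚ ℂ) 𝓜.M (𝓜.classifyingMap (specOver ℚ ℂ) Q) = Φ s) :
    ∀ (s : ComplexPoints S'') (Z : siegelUpperHalfSpace g)
      (P' : PolarizedAbelianSchemeWithLevel g N' δ (specOver ℚ ℂ).left),
      IsAdmissibleAt hδ r' Z.1 Z.2 P' →
      AlgPoints.baseChangeEquiv (algebraMap ℚ ℂ) 𝓜'.M (𝓜'.classifyingMap (specOver ℚ ℂ) P') = AlgPoints.map (L := ℂ) ι' s →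
      ∃ P : PolarizedAbelianSchemeWithLevel g N δ (specOver ℚ ℂ).left,
        IsAdmissibleAt hδ r (θ Z).1 (θ Z).2 P ∧
        AlgPoints.baseChangeEquiv (algebraMap ℚ ℂ) 𝓜.M (𝓜.classifyingMap (specOver ℚ ℂ) P) = Φ s := by
  intro s Z P' hadm hcls
  obtain ⟨U, hU, Q, ψ, hψ, hdim, hker, hsurj, hlev, hW, hclsQ⟩ := hquot s
  haveI := hψ
  -- `P′` and `U` have the same class, hence are isomorphic triples; transport admissibility to `U`
  have hclsU : 𝓜'.classifyingMap (specOver ℚ ℂ) U = 𝓜'.classifyingMap (specOver ℚ ℂ) P' := by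
    apply (AlgPoints.baseChangeEquiv (algebraMap ℚ ℂ) 𝓜'.M).injective
    rw [hU, hcls]
  obtain ⟨G, Ĝ, hBC⟩ := (𝓜'.classifyingMap_eq_iff_exists_isBaseChangeVia_id U P').1 hclsU
  have hadmU : IsAdmissibleAt hδ r' Z.1 Z.2 U := isAdmissibleAt_of_isBaseChangeVia_id' hδ hBC hadm
  refine ⟨Q, ?_, hclsQ⟩
  exact isAdmissibleAt_heckeQuotient_of_sectionKernel hδ hg hN hd hd0 Z.1 Z.2 (θ Z).1 (θ Z).2 r r' hr γq ν (hθ Z) hQA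
    hQA3 U Q ψ hdim hker hsurj hlev hW hadmU

end Literature.AlgebraicGeometry.ModuliOfAbelianVarieties

end
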